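import Mathlib
import Literature.Combinatorics.StablePolynomials.Basic
import Literature.Combinatorics.StablePolynomials.Limits
import HarnessLib

/-!
# Gurvits' capacity step: killing one variable after differentiation

The elementary bookkeeping of L. Gurvits' proof of the van der Waerden bound
(*Van der Waerden/Schrijver–Valiant like conjectures and stable homogeneous polynomials: one
theorem for all*, Electron. J. Combin. 15 (2008) R66, §3–4; exposition: M. Laurent, A. Schrijver,
Amer. Math. Monthly 117 (2010) 903–911).  For a polynomial `q ∈ R[z_σ]` and a coordinate `i`,
the STEP is `q ↦ q⁻ := (∂ᵢ q)|_{zᵢ := 0} = bind₁ (update X i (C 0)) (pderiv i q)`.  We prove: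

* `coeff_bind₁_update_zero`, `coeff_step` — coefficient formulas
  (`coeff_m q⁻ = [m i = 0] · coeff_{m + eᵢ} q`);
* `step_eq_zero_or_isRealStable` — the step keeps "zero or real stable" (tree:
  `IsUpperHalfPlaneStable.pderiv`, `.specialize_real`);
* `coeff_step_nonneg`, `totalDegree_step_le`, `coeff_sum_single_step` — nonnegativity, degree drop,
  and the multilinear coefficient `coeff_{Σ_{j∈S} e_j} q⁻ = coeff_{Σ_{j ∈ S ∪ {i}} e_j} q`;
* the univariate RESTRICTION `R(t) = q(x with xᵢ := t)` realised as
  `aeval (fun j => if j = i then X else C (x j)) q ∈ R[t]`: its expansion `restr_eq_sum`, its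
  coefficients (`coeff_restr`, `coeff_restr_nonneg`), its degree (`natDegree_restr_le`), its values
  (`eval_restr`) and the key identity `coeff_one_restr_eq_eval_step`: `coeff₁ R = q⁻(x)`.

The capacity inequality itself (`coeff₁ R ≥ ((K-1)/K)^{K-1} · inf_t R(t)/t` for real-rooted `R`) is
`Gurvits.coeff_one_ge_of_realRooted` in `GurvitsCapacityUnivariate.lean`; real-rootedness of the
restriction is `IsRealStable.aeval_line_eq_zero_or_im_eq_zero` in `RealRootedRestriction.lean`; the
iteration proving the van der Waerden bound is in
`Literature/Combinatorics/Enumerative/VanDerWaerdenPermanentProof.lean`.  No named facts here.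
-/

noncomputable section

open MvPolynomial Finset
open scoped BigOperators

namespace Literature.Combinatorics.StablePolynomials

namespace Gurvits

variable {σ : Type*}

/-! ### Coefficients of the step -/

/-- Coefficients after killing one variable: `coeff_m (p|_{zᵢ := 0})` is `coeff_m p` if `m i = 0`
and `0` otherwise. [folklore] -/
theorem coeff_bind₁_update_zero [DecidableEq σ] {R : Type*} [CommSemiring R]
    (p : MvPolynomial σ R) (i : σ) (m : σ →₀ ℕ) :
    coeff m (bind₁ (Function.update X i (C 0)) p) = if m i = 0 then coeff m p else 0 := by
  induction p using MvPolynomial.induction_on' with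
  | add p q hp hq =>
    simp only [map_add, coeff_add, hp, hq]
    split_ifs <;> simp
  | monomial d a =>
    rw [bind₁_monomial]
    by_cases hd : d i = 0
    · have hprod : (∏ j ∈ d.support, (Function.update X i (C (0 : R))) j ^ d j) =
          monomial d (1 : R) := by
        rw [monomial_eq, C_1, one_mul, Finsupp.prod]
        refine Finset.prod_congr rfl fun j hj => ?_
        rw [Function.update_of_ne]
        rintro rfl
        exact (Finsupp.mem_support_iff.mp hj) hd
      rw [hprod, C_mul_monomial, mul_one, coeff_monomial]
      by_cases hdm : d = m
      · subst hdm
        rw [if_pos rfl, if_pos hd]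
      · rw [if_neg hdm]
        split_ifs <;> rfl
    · have hprod : (∏ j ∈ d.support, (Function.update X i (C (0 : R))) j ^ d j) = 0 :=
        Finset.prod_eq_zero (Finsupp.mem_support_iff.mpr hd)
          (by rw [Function.update_self, ← C_pow, zero_pow hd, C_0])
      rw [hprod, mul_zero, coeff_zero, coeff_monomial]
      split_ifs with h1 h2
      · exfalso
        subst h2
        exact hd h1
      · rfl
      · rfl

/-- **Coefficients of the step**: `coeff_m ((∂ᵢ q)|_{zᵢ := 0}) = coeff_{m + eᵢ} q` if `m i = 0`,
and `0` otherwise. [folklore] -/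
theorem coeff_step [DecidableEq σ] {R : Type*} [CommSemiring R] (q : MvPolynomial σ R) (i : σ)
    (m : σ →₀ ℕ) :
    coeff m (bind₁ (Function.update X i (C 0)) (pderiv i q)) =
      if m i = 0 then coeff (m + Finsupp.single i 1) q else 0 := by
  rw [coeff_bind₁_update_zero, coeff_pderiv]
  split_ifs with h
  · rw [h]
    simp
  · rfl

/-- The step preserves nonnegativity of all coefficients. [folklore] -/
theorem coeff_step_nonneg [DecidableEq σ] {q : MvPolynomial σ ℝ} (hq : ∀ m, 0 ≤ coeff m q) (i : σ)
    (m : σ →₀ ℕ) : 0 ≤ coeff m (bind₁ (Function.update X i (C 0)) (pderiv i q)) := by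
  rw [coeff_step]
  split_ifs
  · exact hq _
  · exact le_rfl

/-- The step lowers the total degree by one (`deg q ≤ k + 1 ⇒ deg q⁻ ≤ k`). [folklore] -/
theorem totalDegree_step_le [DecidableEq σ] {R : Type*} [CommSemiring R] (q : MvPolynomial σ R)
    (i : σ) {k : ℕ} (hq : q.totalDegree ≤ k + 1) :
    (bind₁ (Function.update X i (C 0)) (pderiv i q)).totalDegree ≤ k := by
  rw [totalDegree, Finset.sup_le_iff]
  intro m hm
  rw [mem_support_iff, coeff_step] at hm
  split_ifs at hm with h
  · have hmem : m + Finsupp.single i 1 ∈ q.support := mem_support_iff.mpr hm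
    have h1 := le_totalDegree hmem
    rw [Finsupp.sum_add_index' (fun _ => rfl) (fun _ _ _ => rfl),
      Finsupp.sum_single_index rfl] at h1
    change (m.sum fun _ e => e) ≤ k
    omega
  · exact absurd rfl hm

/-- **The multilinear coefficient passes through the step**: for `i ∉ S`,
`coeff_{Σ_{j∈S} eⱼ} ((∂ᵢ q)|_{zᵢ := 0}) = coeff_{Σ_{j∈S∪{i}} eⱼ} q`. [folklore] -/
theorem coeff_sum_single_step [DecidableEq σ] {R : Type*} [CommSemiring R] (q : MvPolynomial σ R)
    {i : σ} {S : Finset σ} (hi : i ∉ S) :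
    coeff (∑ j ∈ S, Finsupp.single j 1) (bind₁ (Function.update X i (C 0)) (pderiv i q)) =
      coeff (∑ j ∈ insert i S, Finsupp.single j 1) q := by
  have h0 : (∑ j ∈ S, Finsupp.single j (1 : ℕ)) i = 0 := by
    rw [Finsupp.finsetSum_apply]
    refine Finset.sum_eq_zero fun j hj => ?_
    rw [Finsupp.single_apply, if_neg]
    rintro rfl
    exact hi hj
  rw [coeff_step, if_pos h0, Finset.sum_insert hi, add_comm]

/-! ### The step keeps "zero or real stable" -/

/-- **Gurvits' step keeps "zero or real stable"**: if `q ∈ ℝ[z_σ]` is `0` or real stable then so is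
`(∂ᵢ q)|_{zᵢ := 0}` (`∂ᵢ` preserves stability, Brändén 2007 Prop. 3.3 / Wagner 2011 Lemma 2.4 (f);
real specialisation gives `0` or stable, Borcea–Brändén 2009 Lemma 1.7 (1)).
[cite: Branden2007, Prop. 3.3] -/
theorem step_eq_zero_or_isRealStable [Fintype σ] [DecidableEq σ] {q : MvPolynomial σ ℝ}
    (hq : q = 0 ∨ IsRealStable q) (i : σ) :
    bind₁ (Function.update X i (C 0)) (pderiv i q) = 0 ∨
      IsRealStable (bind₁ (Function.update X i (C 0)) (pderiv i q)) := by
  rcases hq with rfl | hq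
  · left
    simp
  have hfun : (fun j => map (algebraMap ℝ ℂ) (Function.update X i (C (0 : ℝ)) j)) =
      Function.update X i (C (((0 : ℝ) : ℂ))) := by
    funext j
    by_cases hj : j = i
    · subst hj
      simp
    · simp [Function.update_of_ne hj]
  have key : map (algebraMap ℝ ℂ) (bind₁ (Function.update X i (C 0)) (pderiv i q)) =
      bind₁ (Function.update X i (C (((0 : ℝ) : ℂ)))) (pderiv i (map (algebraMap ℝ ℂ) q)) := by
    rw [map_bind₁, pderiv_map, hfun]
  have hinj : Function.Injective (map (algebraMap ℝ ℂ) : MvPolynomial σ ℝ → MvPolynomial σ ℂ) :=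
    map_injective _ (algebraMap ℝ ℂ).injective
  rcases IsUpperHalfPlaneStable.pderiv hq i with h0 | hst
  · left
    apply hinj
    rw [key, h0, map_zero, map_zero]
  · rcases hst.specialize_real i 0 with h0 | hst'
    · left
      apply hinj
      rw [key, map_zero, h0]
    · right
      show IsUpperHalfPlaneStable _
      rw [key]
      exact hst'

/-! ### The univariate restriction `R(t) = q(x with xᵢ := t)` -/

/-- **Expansion of the restriction**: `q(x with xᵢ := X) = Σ_μ (coeff_μ q · Π_{j≠i} x_j^{μ_j}) X^{μ_i}`.
[folklore] -/
theorem restr_eq_sum [Fintype σ] [DecidableEq σ] (q : MvPolynomial σ ℝ) (x : σ → ℝ) (i : σ) :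
    aeval (fun j => if j = i then (Polynomial.X : Polynomial ℝ) else Polynomial.C (x j)) q =
      ∑ μ ∈ q.support, Polynomial.C (coeff μ q * ∏ j ∈ univ.erase i, x j ^ μ j) *
        Polynomial.X ^ μ i := by
  conv_lhs => rw [q.as_sum, map_sum]
  refine Finset.sum_congr rfl fun μ _ => ?_
  rw [aeval_monomial, Finsupp.prod_fintype _ _ (fun j => by simp),
    ← Finset.mul_prod_erase univ _ (mem_univ i), if_pos rfl]
  have hrest : (∏ j ∈ univ.erase i,
      (if j = i then (Polynomial.X : Polynomial ℝ) else Polynomial.C (x j)) ^ μ j) =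
      Polynomial.C (∏ j ∈ univ.erase i, x j ^ μ j) := by
    rw [map_prod]
    refine Finset.prod_congr rfl fun j hj => ?_
    rw [if_neg (Finset.ne_of_mem_erase hj), Polynomial.C_pow]
  rw [hrest, Polynomial.algebraMap_eq, map_mul]
  ring

/-- Coefficients of the restriction. [folklore] -/
theorem coeff_restr [Fintype σ] [DecidableEq σ] (q : MvPolynomial σ ℝ) (x : σ → ℝ) (i : σ) (k : ℕ) :
    (aeval (fun j => if j = i then (Polynomial.X : Polynomial ℝ) else Polynomial.C (x j)) q).coeff k =
      ∑ μ ∈ q.support, if μ i = k then coeff μ q * ∏ j ∈ univ.erase i, x j ^ μ j else 0 := by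
  rw [restr_eq_sum, Polynomial.finsetSum_coeff]
  refine Finset.sum_congr rfl fun μ _ => ?_
  rw [Polynomial.coeff_C_mul_X_pow]
  by_cases h : μ i = k
  · rw [if_pos h.symm, if_pos h]
  · rw [if_neg (Ne.symm h), if_neg h]

/-- The restriction at a nonnegative point of a polynomial with nonnegative coefficients has
nonnegative coefficients. [folklore] -/
theorem coeff_restr_nonneg [Fintype σ] [DecidableEq σ] {q : MvPolynomial σ ℝ}
    (hq : ∀ m, 0 ≤ coeff m q) {x : σ → ℝ} (hx : ∀ j, 0 ≤ x j) (i : σ) (k : ℕ) :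
    0 ≤ (aeval (fun j => if j = i then (Polynomial.X : Polynomial ℝ) else Polynomial.C (x j)) q).coeff k := by
  rw [coeff_restr]
  refine Finset.sum_nonneg fun μ _ => ?_
  split_ifs
  · exact mul_nonneg (hq μ) (Finset.prod_nonneg fun j _ => pow_nonneg (hx j) _)
  · exact le_rfl

/-- The degree of the restriction is at most the total degree. [folklore] -/
theorem natDegree_restr_le [Fintype σ] [DecidableEq σ] (q : MvPolynomial σ ℝ) (x : σ → ℝ) (i : σ) :
    (aeval (fun j => if j = i then (Polynomial.X : Polynomial ℝ) else Polynomial.C (x j)) q).natDegree ≤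
      q.totalDegree := by
  rw [restr_eq_sum]
  refine Polynomial.natDegree_sum_le_of_forall_le _ _ fun μ hμ => ?_
  refine (Polynomial.natDegree_C_mul_X_pow_le _ _).trans ?_
  refine le_trans ?_ (le_totalDegree hμ)
  by_cases h : μ i = 0
  · rw [h]
    exact Nat.zero_le _
  · rw [Finsupp.sum]
    exact Finset.single_le_sum (f := fun j => μ j) (fun _ _ => Nat.zero_le _)
      (Finsupp.mem_support_iff.mpr h)

/-- **Values of the restriction**: `R(t) = q(x with xᵢ := t)` for real `t`. [folklore] -/
theorem eval_restr [DecidableEq σ] (q : MvPolynomial σ ℝ) (x : σ → ℝ) (i : σ) (t : ℝ) :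
    (aeval (fun j => if j = i then (Polynomial.X : Polynomial ℝ) else Polynomial.C (x j)) q).eval t =
      eval (fun j => if j = i then t else x j) q := by
  induction q using MvPolynomial.induction_on with
  | C a => simp
  | add p q hp hq => simp only [map_add, Polynomial.eval_add, hp, hq]
  | mul_X p j hp =>
    simp only [map_mul, Polynomial.eval_mul, hp, aeval_X, eval_X]
    by_cases h : j = i
    · subst h
      simp
    · simp [h]

/-- **The linear coefficient of the restriction is the value of the step**:
`coeff₁ (q(x with xᵢ := t)) = ((∂ᵢ q)|_{zᵢ := 0})(x)` (both are
`Σ_{μ : μ_i = 1} coeff_μ q · Π_{j≠i} x_j^{μ_j}`). [folklore] -/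
theorem coeff_one_restr_eq_eval_step [Fintype σ] [DecidableEq σ] (q : MvPolynomial σ ℝ)
    (x : σ → ℝ) (i : σ) :
    (aeval (fun j => if j = i then (Polynomial.X : Polynomial ℝ) else Polynomial.C (x j)) q).coeff 1 =
      eval x (bind₁ (Function.update X i (C 0)) (pderiv i q)) := by
  rw [coeff_restr, MvPolynomial.eval_eq', ← Finset.sum_filter]
  symm
  refine Finset.sum_nbij' (fun m => m + Finsupp.single i 1) (fun μ => μ - Finsupp.single i 1)
    ?_ ?_ ?_ ?_ ?_
  · intro m hm
    rw [mem_support_iff, coeff_step] at hm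
    rw [Finset.mem_filter, mem_support_iff]
    split_ifs at hm with h
    · refine ⟨hm, ?_⟩
      simp [h]
    · exact absurd rfl hm
  · intro μ hμ
    rw [Finset.mem_filter] at hμ
    obtain ⟨hμ, h1⟩ := hμ
    have hle : Finsupp.single i 1 ≤ μ := Finsupp.single_le_iff.mpr (by omega)
    rw [mem_support_iff, coeff_step, if_pos, tsub_add_cancel_of_le hle]
    · exact mem_support_iff.mp hμ
    · simp [h1]
  · intro m _
    exact add_tsub_cancel_right _ _
  · intro μ hμ
    rw [Finset.mem_filter] at hμ
    exact tsub_add_cancel_of_le (Finsupp.single_le_iff.mpr (by omega))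
  · intro m hm
    rw [mem_support_iff, coeff_step] at hm
    split_ifs at hm with h
    · rw [coeff_step, if_pos h, ← Finset.mul_prod_erase univ _ (mem_univ i), h, pow_zero, one_mul]
      congr 1
      refine Finset.prod_congr rfl fun j hj => ?_
      rw [Finsupp.add_apply, Finsupp.single_apply, if_neg (Finset.ne_of_mem_erase hj).symm, add_zero]
    · exact absurd rfl hm

end Gurvits

end Literature.Combinatorics.StablePolynomials

end
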